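import Summits.QuantumFields.YangMills.Theorems.ParabolicTrajectoryLatticeGapOnTrajectoryStubFormatGap
import Summits.QuantumFields.YangMills.Theorems.ParabolicTrajectoryLatticeGapOnTrajectoryStubFormatSlab
import HarnessLib

/-!
# Crux `LatticeGapOnTrajectory` (stmt-QuantumFields-10523): the format step from an anchor `J` octaves up
# (stub `stub_formatOct`, line `step-scaling-contraction`, served slug `StepScalingSketch`, reshape 4)

Helper file (`--supports stmt-QuantumFields-10523`) proving the registered stub `stub_formatOct` of the
skeleton `Cruxes/LatticeGapOnTrajectory/Lines/step_scaling_contraction.lean` (signature verbatim): the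
octave generalisation of the two landed format stubs `stub_formatGap` (p130840) and `stub_formatSlab`
(p130133), the case `J = 0`. A rate floor `RateFloor r sch (fun k => 2 ^ J * M ^ n k) κ Δ` (the
finite-volume OS gap statement `TorusGapAt` at the lattice rate `Δ · a_k` on EVERY symmetric torus
`S ≥ 2^J M^{n_k}`, eventually in `k`) gives BOTH the summit's per-pair sup-norm lattice gap
`HasLatticeMassGap r sch Δ` AND uniform slab clustering `Transfer.UniformSlabClustering r sch Δ` (constants
`p = 0`, `K = 2 + κ`).

Both landed proofs consume the rate floor only on tori `S ≥ L_k` (gap half) resp. `S = L_k` (slab half),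
and `2^J M^{n_k} ≤ L_k` eventually (`eventually_octave_le_L`: `a_k L_k → ∞` and `a_k = M^{-n_k}` give
`a_k L_k ≥ 2^J` for large `k`). The per-torus core `abs_latticeConnectedCorr_le_of_torusGapAt` (p130840) and
the slab computation (p130133) are unchanged; `hasLatticeMassGap_of_rateFloorOct` and
`uniformSlabClustering_of_rateFloorOct` re-assemble them along the octave eventuality.

References: Osterwalder–Seiler, Ann. Phys. 110 (1978) 440, §2; Glimm–Jaffe, Quantum Physics (1987), §6.1,
§19.7.
-/

open scoped ComplexConjugate Topology
open Filter MeasureTheory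
open Literature.MathematicalPhysics.QuantumLattice Literature.MathematicalPhysics.QuantumFieldTheory
open Summit.QuantumFields.YangMills.Theses.ParabolicTrajectory
open Summit.QuantumFields.YangMills.Cruxes.LatticeGapOnTrajectory.OrbitKantorovichFiniteSize
open Summit.QuantumFields.YangMills.Theorems.LatticeGapOnTrajectory

noncomputable section

namespace Summit.QuantumFields.YangMills.Cruxes.LatticeGapOnTrajectory.StepScaling

/-! ## §1 The octave eventuality -/

/-- **No wrap-around, `J` octaves up.** Under the `M`-adic shape `a_k = M^{-n_k}`, for every `J`, eventually
`2^J M^{n_k} ≤ L_k`: the scheme axiom `a_k L_k → ∞` gives `2^J ≤ a_k L_k = M^{-n_k} L_k` for large `k`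
(the case `J = 0` is `Negative.eventually_sep_le_L`). -/
theorem eventually_octave_le_L {ι : Type} (sch : SpeciesScheme ι) {M : ℕ} {n : ℕ → ℕ}
    (h : ∀ k, sch.a k = ((M : ℝ) ^ n k)⁻¹) (J : ℕ) : ∀ᶠ k in atTop, 2 ^ J * M ^ n k ≤ sch.L k := by
  -- adapted from `Negative.eventually_sep_le_L`
  have hM := Negative.two_le_of_shape sch h
  filter_upwards [sch.tendsto_L.eventually_ge_atTop ((2 : ℝ) ^ J)] with k hk
  rw [h k] at hk
  have hc : (0 : ℝ) < (M : ℝ) ^ n k := by positivity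
  have h1 : (M : ℝ) ^ n k * 2 ^ J ≤ sch.L k := (le_inv_mul_iff₀ hc).1 hk
  have h2 : ((2 ^ J * M ^ n k : ℕ) : ℝ) ≤ sch.L k := by
    push_cast
    linarith [mul_comm ((M : ℝ) ^ n k) (2 ^ J)]
  exact_mod_cast h2

/-! ## §2 The two halves along the octave eventuality -/

section Halves

variable {G : Type} [Group G] [TopologicalSpace G] [IsTopologicalGroup G] [CompactSpace G]
  [MeasurableSpace G] [BorelSpace G]

/-- **Gap half, `J` octaves up** (re-assembly of `stub_formatGap`, p130840). A rate floor on every torus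
`S ≥ 2^J M^{n_k}` gives the summit's per-pair sup-norm lattice gap at the same physical rate: for species
`A, B` (time half-width `w₀` of the two supports), eventually in `k` the floor holds,
`L_k ≥ 2^J M^{n_k} ≥ M^{n_k} ≥ 2w₀ + 3` (`eventually_octave_le_L`, `Negative.tendsto_natPow_of_shape`) and
`β_k ≥ 0`; then on every torus `S ≥ L_k`, for `n ≤ S`, `abs_latticeConnectedCorr_le_of_torusGapAt` at rate
`Δ a_k ≤ Δ` with pair constant `(4(‖A‖² + ‖B‖²) + κ(‖A‖ + ‖B‖)² + 2‖A‖‖B‖) e^{Δ(2w₀+3)}`. -/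
theorem hasLatticeMassGap_of_rateFloorOct (r : LatticeRep G) {M : ℕ} {sch : SpeciesScheme (YMSpecies G)}
    {n : ℕ → ℕ} {J : ℕ} {κ Δ : ℝ} (ha : ∀ k, sch.a k = ((M : ℝ) ^ n k)⁻¹)
    (hβ : Tendsto sch.β atTop atTop) (hκ : 0 ≤ κ) (hΔ : 0 < Δ)
    (hfloor : RateFloor r sch (fun k => 2 ^ J * M ^ n k) κ Δ) : HasLatticeMassGap r sch Δ := by
  -- adapted from `stub_formatGap` (p130840)
  have hM := Negative.two_le_of_shape sch ha
  intro A B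
  obtain ⟨CA, hCA⟩ := A.bounded
  obtain ⟨CB, hCB⟩ := B.bounded
  -- the time half-width of the two supports
  set w₀ : ℕ := (A.supp ∪ B.supp).sup fun e => (e.1 0).natAbs with hw₀
  have hwAB : ∀ e ∈ A.supp ∪ B.supp, |e.1 0| ≤ (w₀ : ℤ) := by
    intro e he
    have h1 : (e.1 0).natAbs ≤ w₀ :=
      Finset.le_sup (f := fun e : Literature.MathematicalPhysics.QuantumLattice.ZdEdge 4 => (e.1 0).natAbs) he
    rw [Int.abs_eq_natAbs]
    exact_mod_cast h1
  have hwA : ∀ e ∈ A.supp, |e.1 0| ≤ (w₀ : ℤ) := fun e he => hwAB e (Finset.mem_union_left _ he)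
  have hwB : ∀ e ∈ B.supp, |e.1 0| ≤ (w₀ : ℤ) := fun e he => hwAB e (Finset.mem_union_right _ he)
  refine ⟨(4 * (CA ^ 2 + CB ^ 2) + κ * (CA + CB) ^ 2 + 2 * (CA * CB)) * Real.exp (Δ * (2 * w₀ + 3)), ?_⟩
  have hK : 0 ≤ 4 * (CA ^ 2 + CB ^ 2) + κ * (CA + CB) ^ 2 + 2 * (CA * CB) := by
    have := (abs_nonneg _).trans (hCA 1); have := (abs_nonneg _).trans (hCB 1); positivity
  have hfloor' : ∀ᶠ k in atTop, ∀ S, 2 ^ J * M ^ n k ≤ S → TorusGapAt r.ρ (sch.β k) S (Δ * sch.a k) κ :=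
    hfloor
  have hbig : ∀ᶠ k in atTop, ((2 * w₀ + 3 : ℕ) : ℝ) ≤ (M : ℝ) ^ n k :=
    (Negative.tendsto_natPow_of_shape sch ha).eventually_ge_atTop _
  filter_upwards [hfloor', eventually_octave_le_L sch ha J, hβ.eventually_ge_atTop 0, hbig] with k hgapk
    hLk hβk hbigk S hS t ht
  have hw3 : 2 * w₀ + 3 ≤ S := by
    have h1 : 2 * w₀ + 3 ≤ M ^ n k := by exact_mod_cast hbigk
    have h2 : M ^ n k ≤ 2 ^ J * M ^ n k := Nat.le_mul_of_pos_left _ (Nat.two_pow_pos J)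
    exact h1.trans (h2.trans (hLk.trans hS))
  have hak1 : sch.a k ≤ 1 := by
    rw [ha k]
    exact inv_le_one_of_one_le₀ (one_le_pow₀ (by exact_mod_cast (by omega : 1 ≤ M)))
  have hm0 : 0 ≤ Δ * sch.a k := (mul_pos hΔ (sch.a_pos k)).le
  have hmΔ : Δ * sch.a k * (2 * w₀ + 3) ≤ Δ * (2 * w₀ + 3) :=
    mul_le_mul_of_nonneg_right (by nlinarith [sch.a_pos k]) (by positivity)
  have h := abs_latticeConnectedCorr_le_of_torusGapAt r hβk hm0 hκ (hgapk S (hLk.trans hS)) A B hCA hCB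
    hwA hwB hw3 ht
  refine h.trans ?_
  rw [show -(Δ * sch.a k * t) = -(Δ * (sch.a k * t)) by rw [mul_assoc]]
  exact mul_le_mul_of_nonneg_right (mul_le_mul_of_nonneg_left (Real.exp_le_exp.2 hmΔ) hK)
    (Real.exp_pos _).le

/-- **Slab half, `J` octaves up** (re-assembly of `stub_formatSlab`, p130133). A rate floor on every torus
`S ≥ 2^J M^{n_k}` gives uniform slab clustering in cluster-expansion format on the scheme's own torus
(`S = L_k ≥ 2^J M^{n_k}` eventually, `eventually_octave_le_L`; `sch.side k = 2 L_k + 1`): for `N + 2w ≤ L_k`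
the thermal exponent `2L_k + 1 − N − 2w ≥ N`, and `osVar X ≤ ‖osCorr id X X‖ ≤ 2B²` (`norm_osCorr_self_le`),
so `‖osCorr τ_N X X‖ ≤ (2 + κ) B² e^{−Δ a_k N}`: constants `p = 0`, `K = 2 + κ`. -/
theorem uniformSlabClustering_of_rateFloorOct (r : LatticeRep G) {M : ℕ}
    {sch : SpeciesScheme (YMSpecies G)} {n : ℕ → ℕ} {J : ℕ} {κ Δ : ℝ}
    (ha : ∀ k, sch.a k = ((M : ℝ) ^ n k)⁻¹) (hκ : 0 ≤ κ) (hΔ : 0 < Δ)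
    (hfloor : RateFloor r sch (fun k => 2 ^ J * M ^ n k) κ Δ) : Transfer.UniformSlabClustering r sch Δ := by
  -- adapted from `stub_formatSlab` (p130133)
  have hM := Negative.two_le_of_shape sch ha
  refine ⟨0, 2 + κ, by linarith, ?_⟩
  have hfloor' : ∀ᶠ k in atTop, ∀ S : ℕ, 2 ^ J * M ^ n k ≤ S →
      TorusGapAt r.ρ (sch.β k) S (Δ * sch.a k) κ := hfloor
  filter_upwards [hfloor', eventually_octave_le_L sch ha J] with k hk hLk
  intro w N X B hX hB hdep hN
  have hD : 1 ≤ 2 ^ J * M ^ n k :=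
    Nat.one_le_iff_ne_zero.2 (Nat.mul_ne_zero (pow_ne_zero _ two_ne_zero) (pow_ne_zero _ (by omega)))
  have hL1 : 1 ≤ sch.L k := hD.trans hLk
  have hw : w < sch.L k := by omega
  have hn : N + 2 * w ≤ 2 * sch.L k + 1 := by omega
  have hm0 : 0 ≤ Δ * sch.a k := (mul_pos hΔ (sch.a_pos k)).le
  -- the finite-volume OS gap statement on the scheme's own torus `S = L_k` (`sch.side k = 2 L_k + 1`)
  have h : ‖osCorr (wilsonMeasure r.ρ (sch.β k)) GaugeConfig.negReflect (torusTimeShift (sch.side k) N)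
        X X‖ ≤
      osVar (wilsonMeasure r.ρ (sch.β k)) GaugeConfig.negReflect X * Real.exp (-(Δ * sch.a k * N)) +
        κ * B ^ 2 * Real.exp (-(Δ * sch.a k * ((2 * sch.L k + 1 : ℝ) - N - 2 * w))) :=
    hk (sch.L k) hLk w N X B hX hB hdep hw hn
  -- the variance term: `osVar X ≤ ‖osCorr id X X‖ ≤ 2 B²`
  haveI := isProbabilityMeasure_wilsonMeasure (d := 4) (L := sch.side k) (G := G) r.ρ r.continuous (sch.β k)
  have hVle : osVar (wilsonMeasure r.ρ (sch.β k)) GaugeConfig.negReflect X ≤ 2 * B ^ 2 :=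
    (Complex.re_le_norm _).trans (norm_osCorr_self_le _ _ _ hB)
  have hV : osVar (wilsonMeasure r.ρ (sch.β k)) GaugeConfig.negReflect X * Real.exp (-(Δ * sch.a k * N)) ≤
      2 * B ^ 2 * Real.exp (-(Δ * sch.a k * N)) :=
    mul_le_mul_of_nonneg_right hVle (Real.exp_pos _).le
  -- the thermal term: `2 L_k + 1 - N - 2 w ≥ N`
  have hexp : Real.exp (-(Δ * sch.a k * ((2 * sch.L k + 1 : ℝ) - N - 2 * w))) ≤
      Real.exp (-(Δ * sch.a k * N)) := by
    rw [Real.exp_le_exp]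
    have hN' : (N : ℝ) + 2 * w ≤ sch.L k := by exact_mod_cast hN
    have hw0 : (0 : ℝ) ≤ w := Nat.cast_nonneg w
    have hle : (N : ℝ) ≤ (2 * sch.L k + 1 : ℝ) - N - 2 * w := by linarith
    have := mul_le_mul_of_nonneg_left hle hm0
    linarith
  have hth : κ * B ^ 2 * Real.exp (-(Δ * sch.a k * ((2 * sch.L k + 1 : ℝ) - N - 2 * w))) ≤
      κ * B ^ 2 * Real.exp (-(Δ * sch.a k * N)) :=
    mul_le_mul_of_nonneg_left hexp (mul_nonneg hκ (sq_nonneg B))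
  have hE : -Δ * sch.a k * N = -(Δ * sch.a k * N) := by ring
  rw [pow_zero, mul_one, hE]
  linarith

end Halves

/-! ## §3 The registered stub -/

/-- **stub_formatOct** (registered stub of the skeleton `Lines/step_scaling_contraction.lean`, signature
verbatim) — FORMAT from a rate floor `J` octaves above the unit box (G-blind; reshape 4). As
`stub_formatGap` ∧ `stub_formatSlab` (p130840, p130133, the case `J = 0`): a rate floor on every torus
`S ≥ 2^J M^{n_k}` still covers the scheme's own torus and every larger one eventually, because
`a_k L_k → ∞` gives `2^J M^{n_k} ≤ L_k` for all large `k` (`eventually_octave_le_L`); the per-torus core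
`abs_latticeConnectedCorr_le_of_torusGapAt` (p130840) and the slab computation (p130133) are unchanged
(`hasLatticeMassGap_of_rateFloorOct`, `uniformSlabClustering_of_rateFloorOct`). The hypothesis `2 ≤ M` is
decoration (`Negative.two_le_of_shape`); `β_k → ∞` is used only for `β_k ≥ 0` (reflection positivity) in
the gap half. (Osterwalder–Seiler 1978 §2; Glimm–Jaffe 1987 §6.1, §19.7.) -/
theorem stub_formatOct :
    ∀ (G : Type) [Group G] [TopologicalSpace G] [IsTopologicalGroup G] [CompactSpace G]
      [MeasurableSpace G] [BorelSpace G] (r : LatticeRep G) (M : ℕ) (sch : SpeciesScheme (YMSpecies G))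
      (n : ℕ → ℕ) (J : ℕ) (κ Δ : ℝ),
        2 ≤ M → (∀ k, sch.a k = ((M : ℝ) ^ n k)⁻¹) → Tendsto sch.β atTop atTop → 0 ≤ κ → 0 < Δ →
        RateFloor r sch (fun k => 2 ^ J * M ^ n k) κ Δ →
        HasLatticeMassGap r sch Δ ∧ Transfer.UniformSlabClustering r sch Δ := by
  intro G _ _ _ _ _ _ r M sch n J κ Δ _ ha hβ hκ hΔ hfloor
  exact ⟨hasLatticeMassGap_of_rateFloorOct r ha hβ hκ hΔ hfloor,
    uniformSlabClustering_of_rateFloorOct r ha hκ hΔ hfloor⟩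

end Summit.QuantumFields.YangMills.Cruxes.LatticeGapOnTrajectory.StepScaling

end
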